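import Literature.NumberTheory.EllipticCurves.PAdicOneVariableSeriesFamilyOfCharacter
import Literature.NumberTheory.EllipticCurves.PAdicOneVariableNormCoherentUnitInduceMomentsTwo
import Literature.NumberTheory.EllipticCurves.PAdicOneVariableSupportOfColemanTraceRelTwo
import Literature.NumberTheory.GaloisRepresentations.LubinTateColemanRelativeCoordGaloisTwo
import Literature.NumberTheory.GaloisRepresentations.LubinTateComparisonDilationLTCoeff
import HarnessLib

/-!
# `p = 2`: the RELATIVE norm-coherent units over an unramified base ARE an additive `[κ]`-equivariant
# series family — the hypotheses `hadd`/`hgal` of `PAdicOneVariableSeriesFamilyOfCharacter.lean` discharged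
# for `φ b := j((δ_E g_{η b})~)` (de Shalit I.3.4 Lemma (i)/(ii) over `k' = E`, II.4.5–4.6)

Topic `NumberTheory/EllipticCurves`; namespace `Literature.NumberTheory.EllipticCurves`.

De Shalit, *Iwasawa theory of elliptic curves with complex multiplication* (1987), I.3.4 Lemma (i)/(ii) (p. 18),
I.3.8 and II.4.5–4.6 (p. 58–59): the semi-local units of the CM application live in the RELATIVE Lubin–Tate towers
over the unramified bases `k' = K(𝔣)_𝔓 ⊇ K_𝔭 = ℚ₂`; the measure of a norm-coherent unit `β` is read from the
log-free series `(δ_{k'} g_β)~ ∈ 𝒪_{k'}⟦X⟧ ⊆ 𝐃⟦X⟧` (`𝐃 = 𝒪̂_{F^nr}`), and Lemma I.3.4 needs exactly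
(i) `(δ g_{ββ'})~ = (δ g_β)~ + (δ g_{β'})~` and (ii) `(δ g_{σβ})~ = κ(σ)·((δ g_β)~ ∘ [κ(σ)]_{f'})`.

The β-agnostic files `PAdicOneVariableSeriesFamily{OfCharacter, MomentsOfCharacter, GlueOfCharacter}` take these
two properties of a family `φ : B → 𝐃⟦X⟧` as hypotheses `hadd`/`hgal`; `PAdicOneVariableSeriesFamilyOfNormCoherentUnits`
discharged them for the ABSOLUTE units of `F`.  THIS file discharges them for the RELATIVE units of the tree's
relative Coleman theory (`LubinTateColemanRelative*Two`: `RelNormCoherentUnits hπ E` along `E·K_π^{m+1}`, `E ⊆ F^{nr}`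
finite Galois, `q = 2`, `π = u·2`; relative Coleman series `g_β` with `𝒩_E g_β = g_β^φ`, `δ_E`, and the twisted
log-free series `relTildeSeries` `= δ_E g_β − u_L·((δ_E g_β)^φ ∘ f)`), read in `𝐃⟦X⟧` through ANY ring map
`j : 𝒪_E →+* 𝐃` over `𝒪_F` (hypothesis `hj : j ∘ (𝒪_F → 𝒪_E) = (𝒪_F → 𝐃)`; the canonical one is
`𝒪_E ⊆ 𝒪_{F^nr} → 𝒪̂_{F^nr}`):

* `map_relTildeSeries_mul` — `j((δ g_{ββ'})~) = j((δ g_β)~) + j((δ g_{β'})~)` (`relTildeSeries_mul`);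
* `map_homE_eq_homC'` — `j([a]_{f'}) = homC' h2 u a` (the relative files' `homE` vs the transport files' `homC'`:
  `[a]` depends only on the series, `map_hom_LTCoeff_eq_homC'`);
* ★ `map_relTildeSeries_galAct` — **`j((δ g_{σ̃·β})~) = C(ι χ_π(σ̃)) · (j((δ g_β)~) ∘ homC' (χ_π(σ̃)))`** for `σ̃ ∈ Γ_F`
  fixing `E` pointwise (`relTildeSeries_galAct`, cf2c-w7) — de Shalit's Lemma I.3.4 (ii) over `k'` in the `𝐃`-currency;
* ★ `seriesFamily_hadd_of_relNormCoherentUnits`, ★ `seriesFamily_hgal_of_relNormCoherentUnits` — the two hypotheses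
  of the series-family files VERBATIM for `φ b := j((δ_E g_{η b})~)`, from `hηmul : η (b b') = η b · η b'` and
  `hη : ∀ g ∈ U_0, ∃ σ̃ ∈ Γ_F fixing E, η (g • b) = (η b).galAct σ̃ ∧ e(χ_π(σ̃)) = κ g`
  (in the CM application `Gal(K(𝔣𝔭^∞)/K(𝔣))` is the image of the LOCAL INERTIA at `𝔭` — II.1.10 Corollary —
  whose elements fix every unramified `E`, so `hη` asks for inertia elements only);
* ★ `map_subst_compSeriesC_map_eq` (currency bridge `Θ = θ ∘ (𝒪_{ℂ_F} ⊆ ℂ_F) ∘ (𝐃 → 𝒪_{ℂ_F})`, given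
  `hjC : (𝐃 → 𝒪_{ℂ_F}) ∘ j = (𝒪_E ⊆ 𝒪_{ℂ_F})`) and ★ `seriesFamily_hsock_of_relNormCoherentUnits` — the SOCKET
  hypothesis `hsock` of `PAdicOneVariableSeriesFamily{MomentsOfCharacter, GlueOfCharacter}` (de Shalit's (11):
  `∫_{ℤ₂ˣ} x^{k+1} d((x⁻¹ D_{H_b})|_{ℤ₂ˣ}) = [S^0] D^k H_b`) for the relative units, from `𝒮_E((δ g_β)~) = 0`
  (`relTraceTwo_relTildeSeries`) and the relative trace-zero socket
  `integral_restrictUnits_density_unitInv_pow_succ_of_relTraceTwo_eq_zero`.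

So the relative units over an unramified base instantiate ALL hypotheses of the series-family package
(`hadd`, `hgal`, `hsock`), exactly as `PAdicOneVariableSeriesFamilyOfNormCoherentUnits(Socket)` did for the
absolute units.  Everything is proved; no named facts, no definitions, no instances (section-local instance attributes as in the
siblings), no `sorry`.

## References

* [deShalit1987] E. de Shalit, *Iwasawa theory of elliptic curves with complex multiplication* (1987),
  I.3.3 (7)–(8) (p. 17), I.3.4 Lemma (i), (ii) (p. 18), I.3.5 (11) (p. 18), I.3.8 (p. 20), II.1.10 Corollary
  (p. 39), II.4.5–4.6 (12)–(14) (p. 58–59).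
-/

noncomputable section

open MvPowerSeries

namespace Literature.NumberTheory.EllipticCurves

section SeriesFamilyOfRelNormCoherentUnits

open ValuativeRel IsLocalRing Field
open Literature.NumberTheory.GaloisRepresentations Literature.NumberTheory.GaloisRepresentations.IsNonarchimedeanLocalField
  Literature.NumberTheory.GaloisRepresentations.LubinTate Literature.NumberTheory.PAdicHodge

variable {F : Type} [Field F] [ValuativeRel F] [TopologicalSpace F] [IsNonarchimedeanLocalField F]

attribute [local instance] ltNormUniformSpace ltNormIsUniformAddGroup rk1 nF nE fintypeResidueField

variable (h2 : (valuation F).IsUniformizer (((2 : ℕ) : 𝒪[F]) : F)) (u : 𝒪[F]ˣ)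
variable (E : IntermediateField F (AlgebraicClosure F)) [FiniteDimensional F E] [Normal F E] [IsGalois F E]
  (hq : residueFieldCard F = 2) (hE : E ≤ maxUnramified F) {σ₀ : absoluteGaloisGroup F} (hσ₀ : IsAbsArithFrob σ₀)
  (uL : LTCoeff F)
  (j : unitBall E →+* UnrCoeff F)
  (hj : j.comp (algebraMap (LTCoeff F) (unitBall E)) = (intToUnrCoeff F).comp (LTCoeff.of F).symm.toRingHom)

/-! ### §1. Additivity -/

/-- **`j((δ g_{ββ'})~) = j((δ g_β)~) + j((δ g_{β'})~)`** (`δ_E` and the twisted tilde are additive).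
[cite: deShalit1987, I.3.4 Lemma (i) (p. 18)] -/
theorem map_relTildeSeries_mul (β β' : RelNormCoherentUnits (isUniformizer_unit_mul h2 u) E) :
    (relTildeSeries (isUniformizer_unit_mul h2 u) E hq hE hσ₀ uL (β.mul β')).map j =
      (relTildeSeries (isUniformizer_unit_mul h2 u) E hq hE hσ₀ uL β).map j +
        (relTildeSeries (isUniformizer_unit_mul h2 u) E hq hE hσ₀ uL β').map j := by
  rw [relTildeSeries_mul, map_add]

/-! ### §2. The `[a]`-series and the scalars under `j` -/

omit [Normal F E] [IsGalois F E] in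
include hj in
/-- `j` is the identity on `𝒪_F`: `j(a) = ι(a)` for `a ∈ 𝒪_F` (private plumbing). [folklore] -/
private theorem map_algebraMap_integer_eq_intToUnrCoeff (a : 𝒪[F]) :
    j (algebraMap 𝒪[F] (unitBall E) a) = intToUnrCoeff F a := by
  have h := RingHom.congr_fun hj (LTCoeff.of F a)
  exact h

omit [Normal F E] [IsGalois F E] in
include hj in
/-- **`j([a]_{f'}) = homC' h2 u a`**: the relative Coleman files' endomorphism series `homE` (`[a]_{f'}` over `LTCoeff F`
mapped to `𝒪_E⟦X⟧`), read in `𝐃⟦X⟧` through `j`, is the transport files' `homC'` (`[a]` depends only on `f'`).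
[cite: deShalit1987, I.2.3 (iv) (p. 14)] -/
theorem map_homE_eq_homC' (a : 𝒪[F]) :
    (homE (isUniformizer_unit_mul h2 u) E a).map j = homC' h2 u a := by
  rw [homE, ← RingHom.comp_apply (PowerSeries.map j) (PowerSeries.map _), ← PowerSeries.map_comp, hj]
  exact map_hom_LTCoeff_eq_homC' h2 u a

omit [Normal F E] [IsGalois F E] in
include hj in
/-- **`j(G ∘ [a]_{f'}) = j(G) ∘ homC' a`** (`map` commutes with substitution). [cite: deShalit1987, I.2.3 (iv) (p. 14)] -/
theorem map_subst_homE_eq_subst_homC' (a : 𝒪[F]) (G : PowerSeries (unitBall E)) :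
    PowerSeries.map j (G.subst (homE (isUniformizer_unit_mul h2 u) E a)) =
      PowerSeries.subst (homC' h2 u a) (PowerSeries.map j G) := by
  have e : PowerSeries.map j (G.subst (homE (isUniformizer_unit_mul h2 u) E a)) =
      (PowerSeries.map j G).subst ((homE (isUniformizer_unit_mul h2 u) E a).map j) :=
    PowerSeries.map_subst (PowerSeries.HasSubst.of_constantCoeff_zero' (constantCoeff_homE _ E a)) G
  rw [e, map_homE_eq_homC' h2 u E j hj]

/-! ### §3. Lemma I.3.4 (ii) over `k'` in the `𝐃`-currency -/

include hj in
/-- ★ **`j((δ g_{σ̃·β})~) = C(ι χ_π(σ̃)) · (j((δ g_β)~) ∘ homC' (χ_π(σ̃)))`** for `σ̃ ∈ Γ_F` fixing `E` pointwise — de Shalit's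
Lemma I.3.4 (ii) relation for the log-free series of a RELATIVE norm-coherent unit, in the `𝐃`-currency of the
series-family files (`relTildeSeries_galAct` pushed through `j`). [cite: deShalit1987, I.3.4 Lemma (ii) (p. 18), I.2.3 (iv) (p. 14)] -/
theorem map_relTildeSeries_galAct (β : RelNormCoherentUnits (isUniformizer_unit_mul h2 u) E)
    {σ : absoluteGaloisGroup F} (hσE : ∀ x : E, σ • (x : AlgebraicClosure F) = x) :
    (relTildeSeries (isUniformizer_unit_mul h2 u) E hq hE hσ₀ uL (β.galAct σ)).map j =
      PowerSeries.C (intToUnrCoeff F (lubinTateChar (isUniformizer_unit_mul h2 u) σ : 𝒪[F])) *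
        PowerSeries.subst (homC' h2 u (lubinTateChar (isUniformizer_unit_mul h2 u) σ : 𝒪[F]))
          ((relTildeSeries (isUniformizer_unit_mul h2 u) E hq hE hσ₀ uL β).map j) := by
  rw [relTildeSeries_galAct _ E hq hE hσ₀ uL β hσE, map_mul, PowerSeries.map_C,
    map_algebraMap_integer_eq_intToUnrCoeff E j hj, map_subst_homE_eq_subst_homC' h2 u E j hj]

/-! ### §4. The hypotheses `hadd` / `hgal` of the series-family files -/

variable {G : Type*} [Group G] {𝒰 : SubgroupTower G} (κ : G →* ℤ_[2]ˣ) (e : 𝒪[F] →+* ℤ_[2])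
variable {B : Type*} [CommMonoid B] [MulDistribMulAction G B]
  (η : B → RelNormCoherentUnits (isUniformizer_unit_mul h2 u) E)
  (hηmul : ∀ b b' : B, η (b * b') = (η b).mul (η b'))
  (hη : ∀ g ∈ 𝒰.U 0, ∀ b : B, ∃ σ : absoluteGaloisGroup F, (∀ x : E, σ • (x : AlgebraicClosure F) = x) ∧
    η (g • b) = (η b).galAct σ ∧
    Units.map (e : 𝒪[F] →* ℤ_[2]) (lubinTateChar (isUniformizer_unit_mul h2 u) σ) = κ g)

include hηmul in
/-- ★ **`hadd` of the series-family files for the relative norm-coherent units**: the family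
`b ↦ j((δ_E g_{η b})~)` is additive. [cite: deShalit1987, I.3.4 Lemma (i) (p. 18), II.4.6 (p. 59)] -/
theorem seriesFamily_hadd_of_relNormCoherentUnits (b b' : B) :
    (relTildeSeries (isUniformizer_unit_mul h2 u) E hq hE hσ₀ uL (η (b * b'))).map j =
      (relTildeSeries (isUniformizer_unit_mul h2 u) E hq hE hσ₀ uL (η b)).map j +
        (relTildeSeries (isUniformizer_unit_mul h2 u) E hq hE hσ₀ uL (η b')).map j := by
  rw [hηmul]; exact map_relTildeSeries_mul h2 u E hq hE hσ₀ uL j (η b) (η b')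

include hj hη in
/-- ★ **`hgal` of the series-family files for the relative norm-coherent units**: for `g ∈ U_0` acting on `η b`
through a `σ̃ ∈ Γ_F` fixing `E` with `e(χ_π(σ̃)) = κ g`, `j((δ g_{η(g•b)})~) = C(ι a) · (j((δ g_{η b})~) ∘ homC' a)` with
`a = χ_π(σ̃)`, `κ g = e a`. [cite: deShalit1987, I.3.4 Lemma (ii) (p. 18), II.4.6 (14) (p. 59)] -/
theorem seriesFamily_hgal_of_relNormCoherentUnits :
    ∀ g ∈ 𝒰.U 0, ∀ b : B, ∃ a : 𝒪[F], (κ g : ℤ_[2]) = e a ∧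
      (relTildeSeries (isUniformizer_unit_mul h2 u) E hq hE hσ₀ uL (η (g • b))).map j =
        PowerSeries.C (intToUnrCoeff F a) * PowerSeries.subst (homC' h2 u a)
          ((relTildeSeries (isUniformizer_unit_mul h2 u) E hq hE hσ₀ uL (η b)).map j) := by
  intro g hg b
  obtain ⟨σ, hσE, hσ, hκσ⟩ := hη g hg b
  refine ⟨(lubinTateChar (isUniformizer_unit_mul h2 u) σ : 𝒪[F]), ?_, ?_⟩
  · rw [← hκσ]; rfl
  · rw [hσ]; exact map_relTildeSeries_galAct h2 u E hq hE hσ₀ uL j hj (η b) hσE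

/-! ### §5. The socket `hsock` (de Shalit's (11)) for the relative units -/

variable {ε : (maxUnramifiedCompletion F)ˣ}
  (hε : maxUnramifiedCompletion.galAut F σ₀ (ε : maxUnramifiedCompletion F) =
    algebraMap 𝒪[F] (maxUnramifiedCompletion F) (u : 𝒪[F]) * (ε : maxUnramifiedCompletion F))
variable (θ : CompletedAlgClosure F →+* ℂ_[2]) (hθc : Continuous θ)
  (hθ1 : ∀ z : CBall F, ‖θ (z : CompletedAlgClosure F)‖ ≤ 1)
  (hθζ : ∀ ζ' : ℂ_[2], (∃ n : ℕ, ζ' ^ 2 ^ n = 1) →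
    ∃ ζ : CompletedAlgClosure F, (∃ n : ℕ, ζ ^ 2 ^ n = 1) ∧ θ ζ = ζ')
  (hjC : (algebraMap (UnrCoeff F) (CBall F)).comp j = unitBallToCBall E)

omit [Normal F E] [IsGalois F E] in
include hjC in
/-- ★ **Currency bridge for relative coefficients**: composing `j(G)` with `ϑ` over `𝐃` and mapping by
`Θ = θ ∘ (𝒪_{ℂ_F} ⊆ ℂ_F) ∘ (𝐃 → 𝒪_{ℂ_F})` equals composing `G` (read in `𝒪_{ℂ_F}` through `𝒪_E ⊆ 𝒪_{ℂ_F}`) with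
`ϑ` over `𝒪_{ℂ_F}` and mapping by `θ ∘ (𝒪_{ℂ_F} ⊆ ℂ_F)` — the series of the relative support/socket file.
[cite: deShalit1987, I.3.3 (8) (p. 17), I.3.8 (p. 20)] -/
theorem map_subst_compSeriesC_map_eq (G : PowerSeries (unitBall E)) :
    (PowerSeries.subst (compSeriesC h2 hσ₀ u hε) (G.map j)).map
        (θ.comp ((CBall F).subtype.comp (algebraMap (UnrCoeff F) (CBall F)))) =
      (PowerSeries.subst ((compSeriesC h2 hσ₀ u hε).map (algebraMap (UnrCoeff F) (CBall F)))
        (G.map (unitBallToCBall E))).map (θ.comp (CBall F).subtype) := by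
  rw [← hjC, map_subst_map_map (algebraMap (UnrCoeff F) (CBall F)) (hasSubst_compSeriesC h2 hσ₀ u hε) j G]
  exact (MvPowerSeries.map_map _ _ _).symm

include hq hθc hθ1 hθζ hjC in
/-- ★ **`hsock` for the relative norm-coherent units** (`Θ = θ ∘ subtype ∘ algebraMap`, twist unit `u_L = u`, ANY
bound proof in the `Θ`-currency): `∫_{ℤ₂ˣ} x^{k+1} d((x⁻¹ D_{H_β})|_{ℤ₂ˣ}) = [S^0] D^k H_β` with
`H_β = Θ(j((δ_E g_β)~) ∘ ϑ)` — because `𝒮_E((δ_E g_β)~) = 0` (the twisted tilde is trace-zero).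
[cite: deShalit1987, I.3.5 (11) (p. 18), I.3.3 (7)–(8) (p. 17), I.3.8 (p. 20)] -/
theorem seriesFamily_hsock_of_relNormCoherentUnits (β : RelNormCoherentUnits (isUniformizer_unit_mul h2 u) E) {C : ℝ}
    (hC : ∀ k : ℕ, ‖PowerSeries.coeff k ((PowerSeries.subst (compSeriesC h2 hσ₀ u hε)
      ((relTildeSeries (isUniformizer_unit_mul h2 u) E hq hE hσ₀ (LTCoeff.of F (u : 𝒪[F])) β).map j)).map
      (θ.comp ((CBall F).subtype.comp (algebraMap (UnrCoeff F) (CBall F)))))‖ ≤ C) (k : ℕ) :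
    (restrictUnits ((invAmice₁ 2 ((PowerSeries.subst (compSeriesC h2 hσ₀ u hε)
        ((relTildeSeries (isUniformizer_unit_mul h2 u) E hq hE hσ₀ (LTCoeff.of F (u : 𝒪[F])) β).map j)).map
        (θ.comp ((CBall F).subtype.comp (algebraMap (UnrCoeff F) (CBall F))))) hC).density
        (ProfiniteTower.padicInt_isUniform 2) (unitInv ℂ_[2]) uniformContinuous_unitInv norm_unitInv_le)).integral
        (fun x : ℤ_[2] ↦ padicIntCast ℂ_[2] (x ^ (k + 1))) =
      PowerSeries.constantCoeff (mahlerD^[k] ((PowerSeries.subst (compSeriesC h2 hσ₀ u hε)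
        ((relTildeSeries (isUniformizer_unit_mul h2 u) E hq hE hσ₀ (LTCoeff.of F (u : 𝒪[F])) β).map j)).map
        (θ.comp ((CBall F).subtype.comp (algebraMap (UnrCoeff F) (CBall F)))))) := by
  have hbridge := map_subst_compSeriesC_map_eq h2 u E hσ₀ j hε θ hjC
    (relTildeSeries (isUniformizer_unit_mul h2 u) E hq hE hσ₀ (LTCoeff.of F (u : 𝒪[F])) β)
  have h₁ := invAmice₁_μ_congr (p := 2) hbridge hC (norm_coeff_map_le_one θ hθ1 _)
  have h₂ := BoundedDistribution.density_μ_congr_of_μ_eq _ _ h₁ (ProfiniteTower.padicInt_isUniform 2)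
    (unitInv ℂ_[2]) uniformContinuous_unitInv norm_unitInv_le
  have h₃ := restrictUnits_μ_congr_of_μ_eq _ _ h₂
  rw [BoundedDistribution.integral_congr_of_μ_eq _ _ h₃, hbridge]
  exact integral_restrictUnits_density_unitInv_pow_succ_of_relTraceTwo_eq_zero hq h2 hσ₀ u hε θ hθc hθ1 hθζ E _
    (relTraceTwo_relTildeSeries (isUniformizer_unit_mul h2 u) E hq hE hσ₀ (of_unit_mul_two_eq hq u) β) k

end SeriesFamilyOfRelNormCoherentUnits

end Literature.NumberTheory.EllipticCurves

end
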